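import Mathlib
import HarnessLib
import Literature.MathematicalPhysics.QuantumLattice.ScaleZeroMultiplierSmooth
import Literature.MathematicalPhysics.QuantumLattice.HubbardSliceSymbolDifferences
import Summits.HubbardSuperconductivity.HubbardSuperconductivity.Theorems.KLProgrammeKLRegimeEngineScaleZeroOverlapL1

/-!
# K3 engine child (stmt-HubbardSuperconductivity-19855), stub `stub_engine_scale0`, clause (E1-v4)₀: the padded scale-`0` multiplier
# symbol on `(ℤ/4M) × (ℤ/L)²` — closed form, vanishing at the padding seam, and the TIME second differences

Cell gate-hubbard-kl, seat hubbard-kl-k3c2-p1 (row «scale-0 Gram step `stub_engine_scale0`»).  Continuation of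
`KLProgrammeKLRegimeEngineScaleZeroOverlapL1` (`torusSum_le_of_symbol_bounds`: the `cr`/`cc` sizes of the scale-`0` overlap kernel from
three symbol numbers `(N_s, s₀, s₁)` of the padded multiplier `G_ω(q) = F_ω(⟨val q₁⟩, q₂)·[val q₁ < 2M]`, `F = klAnisoFamily … klE0 0`).
Here the symbol is put in CLOSED FORM through the smooth squared-modulus cutoff of `Literature/…/ScaleZeroMultiplierSmooth`
(`G = bgmCutoffSq e₀`, BGM 2006 (2.9)/(2.45)) and k3c4-p2's padded frequency `gridFreq` (`HubbardSliceSymbolDifferences`):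

* `klAnisoFamily_zero_apply` — `F_ω(i, k⃗) = G(ν_i² + e_K(k⃗)²) · ζ̃_{0,ω}(θ(k⃗))` (real);
* `scaleZeroPadded_eq` — for `klE0·β ≤ π(2M+1)` the padded symbol IS `q ↦ G(ω̃_{q₁}² + e_K(q₂)²)·ζ̃_{0,ω}(θ(q₂))` at the padded
  frequency `ω̃_{q₁} = π(2 val q₁ - 2M + 1)/β` for EVERY `q₁ ∈ ℤ/4M` (beyond `2M` both sides vanish: `|ω̃| ≥ e₀`);
* `scaleZeroPadded_eq_zero_of_freq` — it vanishes wherever `|ω̃_{q₁}| ≥ e₀`, in particular (`scaleZeroPadded_eq_zero_of_seam`) at the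
  four seam columns `val q₁ ∈ {0, 1} ∪ [2M-2, 4M)` once `klE0·β ≤ π(2M-3)` (which the engine thresholds give: `β³ ≤ M`);
* **`norm_fwdDiff_two_time_scaleZeroPadded_le`** — the hypothesis `h₀` of `torusSum_le_of_symbol_bounds`: for every `q`,
  `‖Δ²_{(1,0)} G_ω(q)‖ ≤ (2π/β)²·C₀` with the absolute constant `C₀ = C(klE0)` of `exists_second_difference_freq_le` (interior columns:
  three consecutive Matsubara frequencies, mean value twice; seam columns: all three samples vanish).

What then remains of the symbol layer: the support count `N_s` and the two SPACE directions `h₁` (zone-boundary seam + origin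
avoidance of the `e₀`-shell under `FrameOK`, then `exists_second_difference_line_le` with the frame's `UVLineBound μ K 7` and the angular
line bounds) — p4 g6's (d-geom) lane at general `n`, instantiated at `n = 0`.

Everything is proved; no definitions, no named facts, no sorry.
-/

noncomputable section

namespace Summit.HubbardSuperconductivity.HubbardSuperconductivity.Theorems.EngineV8

set_option linter.dupNamespace false -- summit = problem name (single-conjunct summit), D-0017

open Real Finset Literature.MathematicalPhysics.QuantumLattice Literature.Probability.LatticeModels
open Literature.MathematicalPhysics.QuantumLattice.FermiRG
open Summit.HubbardSuperconductivity.HubbardSuperconductivity.Theorems.KLRegimeSplit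
open Summit.HubbardSuperconductivity.HubbardSuperconductivity.Theorems.KLProgrammeLegKernels

variable {L M : ℕ}

/-! ## §1 The scale-`0` multiplier in closed form -/

/-- **The scale-`0` anisotropic multiplier in closed form**: `F_ω(i, k⃗) = G(ν_i² + e_K(k⃗)²) · ζ̃_{0,ω}(θ(k⃗))`, `G = bgmCutoffSq klE0`
(`C₀⁻¹(t) = H₀(γ⁰ t) = H₀(t) = G(t²)`). -/
theorem klAnisoFamily_zero_apply (β μ : ℝ) (K : TrigPolyC4v) (e₀ : ℝ) (ω : Fin (sectorCount 0)) (k : FreqMomentum L M) :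
    klAnisoFamily L M β μ K e₀ 0 ω k =
      ((bgmCutoffSq e₀ (matsubaraFreq β M k.1 ^ 2 + nambuXiCT L μ K k.2 ^ 2) *
          sectorWeightCirc 0 ω (momentumAngle L k.2) : ℝ) : ℂ) := by
  rw [klAnisoFamily, bgmMultiplier, gnScaleCutoff, bgmCutoffSq]
  simp

/-- **The multiplier vanishes at frequencies `|ν| ≥ e₀`** (`0 < e₀`). -/
theorem klAnisoFamily_zero_eq_zero_of_le_abs_freq (β μ : ℝ) (K : TrigPolyC4v) {e₀ : ℝ} (he : 0 < e₀) (ω : Fin (sectorCount 0))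
    (k : FreqMomentum L M) (hk : e₀ ≤ |matsubaraFreq β M k.1|) :
    klAnisoFamily L M β μ K e₀ 0 ω k = 0 := by
  rw [klAnisoFamily_zero_apply]
  have h : bgmCutoffSq e₀ (matsubaraFreq β M k.1 ^ 2 + nambuXiCT L μ K k.2 ^ 2) = 0 := by
    refine bgmCutoffSq_eq_zero_of_le he ?_
    have h1 : e₀ ^ 2 ≤ matsubaraFreq β M k.1 ^ 2 := by
      rw [← sq_abs (matsubaraFreq β M k.1)]
      exact pow_le_pow_left₀ he.le hk 2
    nlinarith [sq_nonneg (nambuXiCT L μ K k.2)]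
  rw [h, zero_mul, Complex.ofReal_zero]

/-- **The multiplier vanishes off the `e₀`-shell of the frame band** (`|e_K(k⃗)| ≥ e₀`). -/
theorem klAnisoFamily_zero_eq_zero_of_le_abs_band (β μ : ℝ) (K : TrigPolyC4v) {e₀ : ℝ} (he : 0 < e₀) (ω : Fin (sectorCount 0))
    (k : FreqMomentum L M) (hk : e₀ ≤ |nambuXiCT L μ K k.2|) :
    klAnisoFamily L M β μ K e₀ 0 ω k = 0 := by
  rw [klAnisoFamily_zero_apply]
  have h : bgmCutoffSq e₀ (matsubaraFreq β M k.1 ^ 2 + nambuXiCT L μ K k.2 ^ 2) = 0 := by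
    refine bgmCutoffSq_eq_zero_of_le he ?_
    have h1 : e₀ ^ 2 ≤ nambuXiCT L μ K k.2 ^ 2 := by
      rw [← sq_abs (nambuXiCT L μ K k.2)]
      exact pow_le_pow_left₀ he.le hk 2
    nlinarith [sq_nonneg (matsubaraFreq β M k.1)]
  rw [h, zero_mul, Complex.ofReal_zero]

/-! ## §2 The padded symbol on `(ℤ/4M) × (ℤ/L)²` in closed form -/

/-- The padded frequency beyond the window is large: for `val q₁ ≥ 2M`, `ω̃_{q₁} ≥ π(2M+1)/β` (`β > 0`). -/
theorem gridFreq_ge_of_le_val {Ng : ℕ} {β : ℝ} (hβ : 0 < β) (q₁ : TorusSite 1 Ng) (h : 2 * M ≤ (q₁ 0).val) :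
    Real.pi * (2 * M + 1) / β ≤ gridFreq M Ng β q₁ := by
  rw [gridFreq]
  refine div_le_div_of_nonneg_right ?_ hβ.le
  refine mul_le_mul_of_nonneg_left ?_ Real.pi_pos.le
  have : (2 * M : ℝ) ≤ ((q₁ 0).val : ℝ) := by exact_mod_cast h
  linarith

/-- **The padded symbol in closed form**: for `klE0·β ≤ π(2M+1)` (any `β > 0`),
`G_ω(q) = G(ω̃_{q₁}² + e_K(q₂)²) · ζ̃_{0,ω}(θ(q₂))` for every `q ∈ (ℤ/4M) × (ℤ/L)²` — inside the window by `klAnisoFamily_zero_apply`,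
beyond it because both sides vanish. -/
theorem scaleZeroPadded_eq [NeZero M] {β : ℝ} (hβ : 0 < β) (hMβ : klE0 * β ≤ Real.pi * (2 * M + 1)) (μ : ℝ) (K : TrigPolyC4v)
    (ω : Fin (sectorCount 0)) (q : TorusSite 1 (2 * (2 * M)) × TorusSite 2 L) :
    (if h : (q.1 0).val < 2 * M then klAnisoFamily L M β μ K klE0 0 ω (⟨(q.1 0).val, h⟩, q.2) else 0) =
      ((bgmCutoffSq klE0 (gridFreq M (2 * (2 * M)) β q.1 ^ 2 + nambuXiCT L μ K q.2 ^ 2) *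
          sectorWeightCirc 0 ω (momentumAngle L q.2) : ℝ) : ℂ) := by
  have he : (0 : ℝ) < klE0 := by norm_num [klE0]
  split_ifs with h
  · rw [klAnisoFamily_zero_apply, matsubaraFreq_eq_gridFreq β q.1 h]
  · have hge := gridFreq_ge_of_le_val (M := M) hβ q.1 (le_of_not_gt h)
    have hω : klE0 ≤ gridFreq M (2 * (2 * M)) β q.1 := by
      have : klE0 ≤ Real.pi * (2 * M + 1) / β := by rw [le_div_iff₀ hβ]; exact hMβ
      exact this.trans hge
    have hz : bgmCutoffSq klE0 (gridFreq M (2 * (2 * M)) β q.1 ^ 2 + nambuXiCT L μ K q.2 ^ 2) = 0 := by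
      refine bgmCutoffSq_eq_zero_of_le he ?_
      nlinarith [sq_nonneg (nambuXiCT L μ K q.2), pow_le_pow_left₀ he.le hω 2]
    rw [hz, zero_mul, Complex.ofReal_zero]

/-- **The padded symbol vanishes wherever the padded frequency is `≥ e₀` in size.** -/
theorem scaleZeroPadded_eq_zero_of_freq [NeZero M] {β : ℝ} (hβ : 0 < β) (hMβ : klE0 * β ≤ Real.pi * (2 * M + 1)) (μ : ℝ)
    (K : TrigPolyC4v) (ω : Fin (sectorCount 0)) (q : TorusSite 1 (2 * (2 * M)) × TorusSite 2 L)
    (hq : klE0 ≤ |gridFreq M (2 * (2 * M)) β q.1|) :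
    (if h : (q.1 0).val < 2 * M then klAnisoFamily L M β μ K klE0 0 ω (⟨(q.1 0).val, h⟩, q.2) else 0) = 0 := by
  have he : (0 : ℝ) < klE0 := by norm_num [klE0]
  rw [scaleZeroPadded_eq hβ hMβ]
  have hz : bgmCutoffSq klE0 (gridFreq M (2 * (2 * M)) β q.1 ^ 2 + nambuXiCT L μ K q.2 ^ 2) = 0 := by
    refine bgmCutoffSq_eq_zero_of_le he ?_
    have h1 : klE0 ^ 2 ≤ gridFreq M (2 * (2 * M)) β q.1 ^ 2 := by
      rw [← sq_abs (gridFreq M (2 * (2 * M)) β q.1)]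
      exact pow_le_pow_left₀ he.le hq 2
    nlinarith [sq_nonneg (nambuXiCT L μ K q.2)]
  rw [hz, zero_mul, Complex.ofReal_zero]

/-- **The four seam columns carry no symbol**: if `klE0·β ≤ π(2M-3)` then the padded symbol vanishes at every `q` with
`val q₁ ∈ {0, 1}` or `2M - 2 ≤ val q₁` (there `|ω̃_{q₁}| ≥ π(2M-3)/β ≥ e₀`). -/
theorem scaleZeroPadded_eq_zero_of_seam [NeZero M] {β : ℝ} (hβ : 0 < β) (hMβ : klE0 * β ≤ Real.pi * (2 * M - 3)) (μ : ℝ)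
    (K : TrigPolyC4v) (ω : Fin (sectorCount 0)) (q : TorusSite 1 (2 * (2 * M)) × TorusSite 2 L)
    (hq : (q.1 0).val ≤ 1 ∨ 2 * M - 2 ≤ (q.1 0).val) :
    (if h : (q.1 0).val < 2 * M then klAnisoFamily L M β μ K klE0 0 ω (⟨(q.1 0).val, h⟩, q.2) else 0) = 0 := by
  have hMβ' : klE0 * β ≤ Real.pi * (2 * M + 1) :=
    hMβ.trans (mul_le_mul_of_nonneg_left (by linarith) Real.pi_pos.le)
  refine scaleZeroPadded_eq_zero_of_freq hβ hMβ' μ K ω q ?_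
  -- `|ω̃| = π|2v - 2M + 1|/β ≥ π(2M-3)/β`
  have hM1 : 1 ≤ M := Nat.one_le_iff_ne_zero.2 (NeZero.ne M)
  have hkey : (2 * M - 3 : ℝ) ≤ |2 * ((q.1 0).val : ℝ) - 2 * M + 1| := by
    by_cases hM2 : 2 ≤ M
    · have hM2' : (2 : ℝ) ≤ M := by exact_mod_cast hM2
      rcases hq with h | h
      · have hv : ((q.1 0).val : ℝ) ≤ 1 := by exact_mod_cast h
        rw [abs_of_nonpos (by linarith)]
        linarith
      · have hv : (2 * M : ℝ) - 2 ≤ ((q.1 0).val : ℝ) := by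
          have h' : 2 * M ≤ (q.1 0).val + 2 := by omega
          have : ((2 * M : ℕ) : ℝ) ≤ (((q.1 0).val + 2 : ℕ) : ℝ) := by exact_mod_cast h'
          push_cast at this; linarith
        rw [abs_of_nonneg (by linarith)]
        linarith
    · have hM1' : M = 1 := by omega
      subst hM1'
      have := abs_nonneg (2 * ((q.1 0).val : ℝ) - 2 * (1 : ℕ) + 1)
      push_cast at this ⊢
      linarith
  calc klE0 ≤ Real.pi * (2 * M - 3) / β := by rw [le_div_iff₀ hβ]; exact hMβ
    _ ≤ Real.pi * |2 * ((q.1 0).val : ℝ) - 2 * M + 1| / β :=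
        div_le_div_of_nonneg_right (mul_le_mul_of_nonneg_left hkey Real.pi_pos.le) hβ.le
    _ = |gridFreq M (2 * (2 * M)) β q.1| := by
        rw [gridFreq, abs_div, abs_mul, abs_of_pos Real.pi_pos, abs_of_pos hβ]

/-! ## §3 The time second differences of the padded symbol (hypothesis `h₀`) -/

/-- The shift `q ↦ q + (1, 0)` on the time torus: `val (x + 1) = (val x + 1) mod Ng` (`Ng > 1`). -/
theorem val_add_one_mod {Ng : ℕ} [NeZero Ng] (x : ZMod Ng) (h1 : 1 < Ng) : (x + 1).val = (x.val + 1) % Ng := by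
  rw [ZMod.val_add, ZMod.val_one_eq_one_mod, Nat.mod_eq_of_lt h1]

/-- Below the top the shift does not wrap: `val (x + 1) = val x + 1` when `val x + 1 < Ng`. -/
theorem val_add_one_of_lt {Ng : ℕ} [NeZero Ng] (x : ZMod Ng) (h : x.val + 1 < Ng) : (x + 1).val = x.val + 1 := by
  rw [val_add_one_mod x (by omega), Nat.mod_eq_of_lt h]

/-- **The time second differences of the padded scale-`0` symbol** (hypothesis `h₀` of `torusSum_le_of_symbol_bounds` with
`(4/(s₀·4M))² = (2π/β)²·C₀`): for `klE0·β ≤ π(2M-3)` and every `q ∈ (ℤ/4M) × (ℤ/L)²`,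
`‖Δ²_{(1,0)} G_ω(q)‖ ≤ (2π/β)²·C₀`, `C₀ = C(klE0)` the constant of `exists_second_difference_freq_le` — interior columns
(`val q₁ ≤ 2M-3`): three consecutive padded frequencies `ω̃, ω̃ + 2π/β, ω̃ + 4π/β` and the mean value theorem twice; the other
columns: all three samples sit on seam columns and vanish. -/
theorem norm_fwdDiff_two_time_scaleZeroPadded_le [NeZero M] {β : ℝ} (hβ : 0 < β) (hMβ : klE0 * β ≤ Real.pi * (2 * M - 3))
    (μ : ℝ) (K : TrigPolyC4v) {C₀ : ℝ} (hC₀0 : 0 ≤ C₀)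
    (hC₀ : ∀ (e ν δ : ℝ), 0 ≤ δ →
      |bgmCutoffSq klE0 ((ν + 2 * δ) ^ 2 + e ^ 2) - 2 * bgmCutoffSq klE0 ((ν + δ) ^ 2 + e ^ 2) + bgmCutoffSq klE0 (ν ^ 2 + e ^ 2)| ≤
        δ ^ 2 * C₀)
    (ω : Fin (sectorCount 0)) (q : TorusSite 1 (2 * (2 * M)) × TorusSite 2 L) :
    ‖(fwdDiff ((fun _ : Fin 1 => (1 : ZMod (2 * (2 * M)))), (0 : TorusSite 2 L)))^[2]
        (fun q : TorusSite 1 (2 * (2 * M)) × TorusSite 2 L =>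
          if h : (q.1 0).val < 2 * M then klAnisoFamily L M β μ K klE0 0 ω (⟨(q.1 0).val, h⟩, q.2) else 0) q‖ ≤
      (2 * Real.pi / β) ^ 2 * C₀ := by
  haveI : NeZero (2 * (2 * M)) := ⟨by have := NeZero.ne M; omega⟩
  have hM1 : 1 ≤ M := Nat.one_le_iff_ne_zero.2 (NeZero.ne M)
  have hMβ' : klE0 * β ≤ Real.pi * (2 * M + 1) := hMβ.trans (mul_le_mul_of_nonneg_left (by linarith) Real.pi_pos.le)
  set u : TorusSite 1 (2 * (2 * M)) × TorusSite 2 L := ((fun _ : Fin 1 => (1 : ZMod (2 * (2 * M)))), (0 : TorusSite 2 L)) with hu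
  set G : TorusSite 1 (2 * (2 * M)) × TorusSite 2 L → ℂ := fun q =>
    if h : (q.1 0).val < 2 * M then klAnisoFamily L M β μ K klE0 0 ω (⟨(q.1 0).val, h⟩, q.2) else 0 with hG
  -- the second forward difference, written out
  have hiter : (fwdDiff u)^[2] G q = G (q + u + u) - 2 * G (q + u) + G q := by
    simp only [Function.iterate_succ, Function.iterate_zero, Function.comp_apply, Function.id_def, fwdDiff]
    ring
  rw [hiter]
  -- the three sample points: second components equal, time values shifted by 1, 2 (mod 4M)
  have hq1 : (q + u).2 = q.2 := by simp [hu]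
  have hq2 : (q + u + u).2 = q.2 := by simp [hu]
  have ht1 : (q + u).1 0 = q.1 0 + 1 := by simp [hu]
  have ht2 : (q + u + u).1 0 = q.1 0 + 1 + 1 := by simp [hu]
  set v : ℕ := (q.1 0).val with hv
  have hvlt : v < 2 * (2 * M) := ZMod.val_lt _
  by_cases hint : v + 3 ≤ 2 * M
  · -- interior: three consecutive frequencies
    have hv1 : ((q + u).1 0).val = v + 1 := by rw [ht1, val_add_one_of_lt _ (by omega)]
    have hv2 : ((q + u + u).1 0).val = v + 2 := by
      rw [ht2, val_add_one_of_lt _ (by rw [val_add_one_of_lt _ (by omega)]; omega), val_add_one_of_lt _ (by omega)]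
    have hf0 : gridFreq M (2 * (2 * M)) β q.1 = gridFreq M (2 * (2 * M)) β q.1 := rfl
    have hf1 : gridFreq M (2 * (2 * M)) β (q + u).1 = gridFreq M (2 * (2 * M)) β q.1 + 2 * Real.pi / β := by
      simp only [gridFreq, hv1, ← hv]; push_cast; field_simp; ring
    have hf2 : gridFreq M (2 * (2 * M)) β (q + u + u).1 = gridFreq M (2 * (2 * M)) β q.1 + 2 * (2 * Real.pi / β) := by
      simp only [gridFreq, hv2, ← hv]; push_cast; field_simp; ring
    rw [show G (q + u + u) = _ from scaleZeroPadded_eq hβ hMβ' μ K ω (q + u + u),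
      show G (q + u) = _ from scaleZeroPadded_eq hβ hMβ' μ K ω (q + u), show G q = _ from scaleZeroPadded_eq hβ hMβ' μ K ω q,
      hq1, hq2, hf1, hf2]
    set ν := gridFreq M (2 * (2 * M)) β q.1
    set e := nambuXiCT L μ K q.2
    set z := sectorWeightCirc 0 ω (momentumAngle L q.2)
    have hz : |z| ≤ 1 := by
      rw [abs_le]
      exact ⟨by linarith [sectorWeightCirc_nonneg 0 (ω : ℤ) (momentumAngle L q.2)], sectorWeightCirc_le_one 0 _ _⟩
    have hmain := hC₀ e ν (2 * Real.pi / β) (by positivity)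
    have hcast : ((bgmCutoffSq klE0 ((ν + 2 * (2 * Real.pi / β)) ^ 2 + e ^ 2) * z : ℝ) : ℂ) -
        2 * ((bgmCutoffSq klE0 ((ν + 2 * Real.pi / β) ^ 2 + e ^ 2) * z : ℝ) : ℂ) +
        ((bgmCutoffSq klE0 (ν ^ 2 + e ^ 2) * z : ℝ) : ℂ) =
        (((bgmCutoffSq klE0 ((ν + 2 * (2 * Real.pi / β)) ^ 2 + e ^ 2) - 2 * bgmCutoffSq klE0 ((ν + 2 * Real.pi / β) ^ 2 + e ^ 2) +
          bgmCutoffSq klE0 (ν ^ 2 + e ^ 2)) * z : ℝ) : ℂ) := by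
      push_cast; ring
    rw [hcast, Complex.norm_real, Real.norm_eq_abs, abs_mul]
    calc _ ≤ (2 * Real.pi / β) ^ 2 * C₀ * 1 := mul_le_mul hmain hz (abs_nonneg _) (by positivity)
      _ = _ := by ring
  · -- seam: all three samples vanish
    have hs0 : G q = 0 := scaleZeroPadded_eq_zero_of_seam hβ hMβ μ K ω q (Or.inr (by omega))
    have hs1 : G (q + u) = 0 := by
      refine scaleZeroPadded_eq_zero_of_seam hβ hMβ μ K ω (q + u) ?_
      rw [ht1]
      by_cases h4 : v + 1 < 2 * (2 * M)
      · rw [val_add_one_of_lt _ (by omega)]; right; omega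
      · -- wrap: `v = 4M - 1`, the shifted value is `0`
        have hv' : v = 2 * (2 * M) - 1 := by omega
        left
        have : (q.1 0 + 1).val = 0 := by
          rw [val_add_one_mod _ (by omega), ← hv, hv', show 2 * (2 * M) - 1 + 1 = 2 * (2 * M) by omega, Nat.mod_self]
        omega
    have hs2 : G (q + u + u) = 0 := by
      refine scaleZeroPadded_eq_zero_of_seam hβ hMβ μ K ω (q + u + u) ?_
      rw [ht2]
      by_cases h4 : v + 2 < 2 * (2 * M)
      · rw [val_add_one_of_lt _ (by rw [val_add_one_of_lt _ (by omega)]; omega), val_add_one_of_lt _ (by omega)]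
        right; omega
      · left
        have h41 : 1 < 2 * (2 * M) := by omega
        rw [val_add_one_mod _ h41, val_add_one_mod _ h41, ← hv]
        have : v + 2 = 2 * (2 * M) ∨ v + 1 = 2 * (2 * M) := by omega
        rcases this with h5 | h5
        · rw [Nat.mod_eq_of_lt (by omega : v + 1 < 2 * (2 * M)), show v + 1 + 1 = 2 * (2 * M) by omega, Nat.mod_self]
          omega
        · rw [h5, Nat.mod_self, zero_add, Nat.mod_eq_of_lt h41]
    rw [hs0, hs1, hs2, mul_zero, sub_zero, add_zero, norm_zero]
    positivity

end Summit.HubbardSuperconductivity.HubbardSuperconductivity.Theorems.EngineV8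

end
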